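import Summits.QuantumFields.YangMills.Theorems.BalabanUVNodesN15SiteCurvedOperatorEntries
import Summits.QuantumFields.YangMills.Theorems.BalabanUVNodesN15BackgroundMatrixByPartsLayerTwoSided
import HarnessLib

/-!
# Route «BalabanUVNodes», cluster K4 «SpineRates» — node N15 = NE2: THE SITE LAYER WITH THE BACKGROUND LIVE IN THE TwoGrid ENTRY CURRENCY, XLII — THE ENTRY-2 BRIDGE: the curved
# King family's entry 2 `X∘N∇*_ν` (parts XXXVI ∕ XL, flat base point) IS dag-n15-c's by-parts entry-2 object `e2OpMBP₂ … ∘ ι_ν` (FILE 19), and its two-grid defect IS FILE 23's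
# object — so the displayed row `h2` of part XL is FILE 23 ★★ `hasMaj_entry2_byParts_matrix₂_of_letters` at the curved King family (no mixed kernel `∇G∇*` anywhere)

Cell `pub-ymgap`, WIDTH SEAT `pub-ymgap-dag-n15-w1` (generation 5; director-ym №197 ∕ HUMAN RULING D-0149, №219 (1); chair R455 (A) ∕ R461; dag-lead KEY MAP v2 INBOX l.35754;
the located sequel (o1) of dag-n15-e g15 INBOX l.39322 ∕ l.39620; dag-n15-d g18 l.40235 (door (2)); CLAIM-7).  `bears_on: R4∕N15 · K3⁸ SpineGivenEndpointR13SepCoPHV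
(stmt-QuantumFields-27366; K3⁷ 20544 aside = lineage)`.  Filed `--kind proof --supports stmt-QuantumFields-27366 --as helper` — COUNT-NEUTRAL.  THEOREMS ONLY (0 `def`,
0 `sorry`).  Imports BY NAME part XXXVI `…N15SiteCurvedOperatorEntries` (p642830: `curvSrcF`, `curvSrcC`; through it part XXXIII `curvXfo`∕`curvXco`, dag-n15-w3 `curvDressed`∕
`covPieces`∕`covPieces_one`∕`gaugePair_one`∕`curvCoefC`∕`curvCoefA`, dag-n15-w2 `expTrField`∕`expTrField_zero`, dag-n15-e Ω-b `kingGT`∕`kingGT₁`) and dag-n15-c FILE 19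
`…N15BackgroundMatrixByPartsLayerTwoSided` (`e2OpMBP₂`; through it FILE 18 ★★ `e0_comp_fgradAdj_eq_e2ByParts_matrix₂`, FILE 2 `E2Unit`, `krowOf`∕`bopOf`∕`injJ`∕`idef_comp_injJ`, M1
`bgPairM`∕`unstackM`∕`stack`); nothing in the tree is modified.

WHY.  dag-n15-w3 defined `curvDressed η τ R S G := bgPairM G (covPieces η τ (gaugePair τ R) G) (curvCoefC …) (curvCoefA …)` — n15-c M1's pair over the doubled direction set — and
at the flat base point `R ≡ 1` (`expTrField e η 0 = 1`, `gaugePair τ 1 = 1`) its pieces ARE `∇_μG`, `∇⁻_μG` (`covPieces_one`: FILE 18's `hDf`∕`hDb`).  Hence FILE 18's identification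
`pr₀X̂ ∘ ∇*_ν = e2ByParts B̂ K̂ ∘ ι_ν` applies VERBATIM to parts XXXIII∕XXXVI's `curvXco V ∘ curvSrcC ν` and `curvXfo A′ ∘ curvSrcF ν` (the two unit hypotheses — the stacked step and
the by-parts `1 + K̂` — are smallness facts of the regime, discharged where the letters live), and the two-grid defect of entry 2 is FILE 23's `𝔇(E₂′, E₂)∘ι_ν` (`idef_comp_injJ`).
WHAT REMAINS for the displayed row `h2` of part XL after this file + part XLI (`hS`∕`hS'`∕`hDS`∕`hSh`∕`hSh'`): FILE 23's coefficient letters for the curved coefficients (rows ∕ fits =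
dag-n15-w2's letters; GRADIENT rows `fgradMat`, translated and gradient fits = new, dag-n15-w2's home), Σ-c's shift-defect row letter `⊗` colour (`hDSh`), the `U ≡ 1` left-piece
letters (in the lineage), and the two units in the regime.

CONTENTS.  §1 ★ `projO_curvDressed_one_comp_fgradAdj` (generic: any lattice, colour type, steps, `η⁻¹ = n`, transporter field `S`, propagator `G`; FILE 18 through `covPieces_one`);
§2 ★★ `curvXco_comp_curvSrcC_eq`, ★★ `curvXfo_comp_curvSrcF_eq` (the curved King family, coarse `n = L^K` and fine `n = L^{K+1}`), ★★ `idef_curvEntry2_eq` (the defect object of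
entry 2 = FILE 23's object `𝔇(e2OpMBP₂′, e2OpMBP₂)∘ι_ν`).

HONEST FRAMING ∕ LIMITS.  Pure algebra (definitional bridges + FILE 18), conditional on the two unit hypotheses exactly as FILE 18 is; no estimate; nothing of [B5]∕[B6]∕[B9]
asserted ((3.42) p. 397 third entry, (3.52)–(3.53) p. 400, (3.63)–(3.65) pp. 402–403 = SHAPES ∕ MECHANISM); King's `A = 0` MODEL dressed by exact adjoint transporters, flat base
point.  It does NOT discharge entry 2; NE2⁺ NOT PRINTED ∕ NOT proved for d = 4; **N15 is NOT discharged**; K3⁸ OPEN, not claimed, skeleton v6 untouched; counts of record UNMOVED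
(typed 28∕28 · discharged 5∕27, A 5∕28); one finite four-torus programme at fixed `ε` — NOT ℝ⁴, NOT infinite volume, NOT OS, NOT a mass gap, NOT Clay; R4 closes the conditional
finite-𝕋⁴ rung `BalabanLadder.UV` only.  Restate-immune (no Theses import).
-/

set_option autoImplicit false

noncomputable section
open scoped BigOperators Matrix Matrix.Norms.Frobenius

namespace Summit.QuantumFields.YangMills.BalabanUVNodes.N15.SiteLayerBg

open Finset
open Literature.MathematicalPhysics.QuantumFieldTheory.Balaban1983to89
open Literature.MathematicalPhysics.QuantumFieldTheory.Balaban1983to89.T4EtaRateDefect (idef)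
open Literature.MathematicalPhysics.QuantumFieldTheory.Balaban1983to89.T4EtaRateCoeffDefect (pull)
open Literature.MathematicalPhysics.QuantumFieldTheory.Balaban1983to89.B5Prop11Plancherel (Tor fine)
open Literature.MathematicalPhysics.QuantumFieldTheory.King1986.Torus (blockOf)
open Literature.MathematicalPhysics.QuantumFieldTheory.Balaban1983to89.Beta.AveragingCorrectionJets (adCLM)
open Summit.QuantumFields.YangMills.BalabanUVNodes.N15.MatrixSpecies (mmulOp liftMap liftEquiv)
open Summit.QuantumFields.YangMills.BalabanUVNodes.N15.BackgroundLayer (projO stack unstackM bgPairM fgradAdj fgradMat injJ krowOf bopOf E2Unit e2OpMBP₂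
  e0_comp_fgradAdj_eq_e2ByParts_matrix₂ idef_comp_injJ)
open Summit.QuantumFields.YangMills.BalabanUVNodes.N15.CurvedSpecies (torStep curvDressed covPieces covPieces_one gaugePair gaugePair_one curvCoefC curvCoefA expTrField)
open Summit.QuantumFields.YangMills.BalabanUVNodes.N15KingModelRung (KingVolIndex)
open Summit.QuantumFields.YangMills.BalabanUVNodes.N15KingModelRung.Curved

/-! ## §1 ★ The generic bridge: n15-w3's dressed pair at the flat base point, entry 0 after `∇*_ν`, IS n15-c's by-parts entry 2 -/

section Generic

variable {X ι J : Type} [Fintype X] [DecidableEq X] [Fintype ι] [DecidableEq ι] [Fintype J] [DecidableEq J] (η n : ℝ) (τ : J → X ≃ X)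
  (S : J → X → Matrix ι ι ℝ) (G : (X × ι → ℝ) →ₗ[ℝ] (X × ι → ℝ))

/-- ★ **THE BRIDGE** (FILE 18 at n15-w3's pair, flat base point): with `η⁻¹ = n`, under the stacked-step unit and the by-parts unit,
`(pr₀ ∘ curvDressed η τ 1 S G) ∘ ∇*_ν = e2OpMBP₂ τ n G (covPieces η τ (gaugePair τ 1) G) (curvCoefC η τ 1 S) (curvCoefA η τ 1 S) ∘ ι_ν`.
[cite: Balaban1985BackgroundPropagators, (3.52)–(3.53) p.400, (3.63)–(3.65) pp.402–403 (mechanism: the right fixed point read after `∇*` and integrated by parts)] -/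
theorem projO_curvDressed_one_comp_fgradAdj (hn : η⁻¹ = n)
    (hunit : IsUnit (1 - LinearMap.toMatrix' (stack G (covPieces η τ (gaugePair τ fun (_ : J) (_ : X) => (1 : Matrix ι ι ℝ)) G) ∘ₗ
      unstackM (curvCoefC η τ (fun _ _ => 1) S) (curvCoefA η τ (fun _ _ => 1) S))))
    (hunit2 : E2Unit (krowOf (fun ν => G ∘ₗ fgradAdj n (liftEquiv (τ ν) ι)) (fun μ => pull ⇑(liftEquiv (τ μ) ι))
      (fun μ => mmulOp (curvCoefA η τ (fun _ _ => 1) S (Sum.inl μ) ∘ ⇑(τ μ).symm)) (fun μ => mmulOp (curvCoefA η τ (fun _ _ => 1) S (Sum.inr μ) ∘ ⇑(τ μ)))))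
    (ν : J) :
    (projO none ∘ₗ curvDressed η τ (fun _ _ => 1) S G) ∘ₗ fgradAdj n (liftEquiv (τ ν) ι) =
      e2OpMBP₂ τ n G (covPieces η τ (gaugePair τ fun (_ : J) (_ : X) => (1 : Matrix ι ι ℝ)) G) (curvCoefC η τ (fun _ _ => 1) S) (curvCoefA η τ (fun _ _ => 1) S) ∘ₗ injJ ν := by
  have hD : covPieces η τ (gaugePair τ fun (_ : J) (_ : X) => (1 : Matrix ι ι ℝ)) G =
      Sum.elim (fun μ => BackgroundLayer.fgrad η⁻¹ (liftEquiv (τ μ) ι) ∘ₗ G) (fun μ => BackgroundLayer.bgrad η⁻¹ (liftEquiv (τ μ) ι) ∘ₗ G) := by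
    rw [gaugePair_one, covPieces_one]
  rw [curvDressed, e2OpMBP₂]
  exact e0_comp_fgradAdj_eq_e2ByParts_matrix₂ τ n G _ _ (fun μ => by rw [hD, ← hn]; rfl) (fun μ => by rw [hD, ← hn]; rfl) hunit hunit2 ν

end Generic

/-! ## §2 ★★ The curved King family: entry 2 of parts XXXVI ∕ XL, coarse and fine, and its two-grid defect object -/

section King

variable {d : ℕ} (L : ℕ) [NeZero L]
variable {n : Type} [Fintype n] [DecidableEq n] (κ : Type) [Fintype κ] [DecidableEq κ] (e : Matrix n n ℂ ≃L[ℝ] (κ → ℝ)) (a : ℝ)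

/-- ★★ **COARSE ENTRY 2 OF THE CURVED KING FAMILY IS THE BY-PARTS OBJECT**: `curvXco V ∘ curvSrcC ν = e2OpMBP₂ τ (L^K) (G ⊗ 1) (covPieces …) (curvCoefC …) (curvCoefA …) ∘ ι_ν` at the flat
base point (`expTrField e η 0 = 1`), `η = L·(L^{K+1})⁻¹`, `η⁻¹ = L^K`, under the two units. [cite: Balaban1985BackgroundPropagators, (3.42) p.397 (third entry, shape), (3.63)–(3.65) pp.402–403] -/
theorem curvXco_comp_curvSrcC_eq (i : KingVolIndex d) (V : (curvBgC L n i).Cfg)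
    (hunit : IsUnit (1 - LinearMap.toMatrix' (stack (kingGT L a 0 i.K (curvCube L i) κ)
      (covPieces ((L : ℝ) * ((L : ℝ) ^ (i.K + 1))⁻¹) (torStep (fine (L ^ i.K) (curvCube L i)))
        (gaugePair (torStep (fine (L ^ i.K) (curvCube L i))) fun (_ : Fin (d + 1)) (_ : Tor (fine (L ^ i.K) (curvCube L i))) => (1 : Matrix κ κ ℝ)) (kingGT L a 0 i.K (curvCube L i) κ)) ∘ₗ
      unstackM (curvCoefC ((L : ℝ) * ((L : ℝ) ^ (i.K + 1))⁻¹) (torStep (fine (L ^ i.K) (curvCube L i))) (fun _ _ => 1)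
          (expTrField e ((L : ℝ) * ((L : ℝ) ^ (i.K + 1))⁻¹) (fun μ y => adCLM ℝ (V μ y))))
        (curvCoefA ((L : ℝ) * ((L : ℝ) ^ (i.K + 1))⁻¹) (torStep (fine (L ^ i.K) (curvCube L i))) (fun _ _ => 1)
          (expTrField e ((L : ℝ) * ((L : ℝ) ^ (i.K + 1))⁻¹) (fun μ y => adCLM ℝ (V μ y)))))))
    (hunit2 : E2Unit (krowOf (fun ν => kingGT L a 0 i.K (curvCube L i) κ ∘ₗ fgradAdj ((L : ℝ) ^ i.K) (liftEquiv (torStep (fine (L ^ i.K) (curvCube L i)) ν) κ))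
      (fun μ => pull ⇑(liftEquiv (torStep (fine (L ^ i.K) (curvCube L i)) μ) κ))
      (fun μ => mmulOp (curvCoefA ((L : ℝ) * ((L : ℝ) ^ (i.K + 1))⁻¹) (torStep (fine (L ^ i.K) (curvCube L i))) (fun _ _ => 1)
          (expTrField e ((L : ℝ) * ((L : ℝ) ^ (i.K + 1))⁻¹) (fun μ y => adCLM ℝ (V μ y))) (Sum.inl μ) ∘ ⇑(torStep (fine (L ^ i.K) (curvCube L i)) μ).symm))
      (fun μ => mmulOp (curvCoefA ((L : ℝ) * ((L : ℝ) ^ (i.K + 1))⁻¹) (torStep (fine (L ^ i.K) (curvCube L i))) (fun _ _ => 1)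
          (expTrField e ((L : ℝ) * ((L : ℝ) ^ (i.K + 1))⁻¹) (fun μ y => adCLM ℝ (V μ y))) (Sum.inr μ) ∘ ⇑(torStep (fine (L ^ i.K) (curvCube L i)) μ)))))
    (ν : Fin (d + 1)) :
    curvXco L κ e a i V ∘ₗ curvSrcC L κ i ν =
      e2OpMBP₂ (torStep (fine (L ^ i.K) (curvCube L i))) ((L : ℝ) ^ i.K) (kingGT L a 0 i.K (curvCube L i) κ)
        (covPieces ((L : ℝ) * ((L : ℝ) ^ (i.K + 1))⁻¹) (torStep (fine (L ^ i.K) (curvCube L i)))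
          (gaugePair (torStep (fine (L ^ i.K) (curvCube L i))) fun (_ : Fin (d + 1)) (_ : Tor (fine (L ^ i.K) (curvCube L i))) => (1 : Matrix κ κ ℝ)) (kingGT L a 0 i.K (curvCube L i) κ))
        (curvCoefC ((L : ℝ) * ((L : ℝ) ^ (i.K + 1))⁻¹) (torStep (fine (L ^ i.K) (curvCube L i))) (fun _ _ => 1)
          (expTrField e ((L : ℝ) * ((L : ℝ) ^ (i.K + 1))⁻¹) (fun μ y => adCLM ℝ (V μ y))))
        (curvCoefA ((L : ℝ) * ((L : ℝ) ^ (i.K + 1))⁻¹) (torStep (fine (L ^ i.K) (curvCube L i))) (fun _ _ => 1)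
          (expTrField e ((L : ℝ) * ((L : ℝ) ^ (i.K + 1))⁻¹) (fun μ y => adCLM ℝ (V μ y)))) ∘ₗ injJ ν := by
  have hL0 : (L : ℝ) ≠ 0 := Nat.cast_ne_zero.mpr (NeZero.ne L)
  have hn : ((L : ℝ) * ((L : ℝ) ^ (i.K + 1))⁻¹)⁻¹ = (L : ℝ) ^ i.K := by
    rw [mul_inv, inv_inv, pow_succ]; field_simp
  rw [curvXco, curvSrcC, expTrField_zero]
  exact projO_curvDressed_one_comp_fgradAdj _ _ _ _ _ hn hunit hunit2 ν

/-- ★★ **FINE ENTRY 2 OF THE CURVED KING FAMILY IS THE BY-PARTS OBJECT**: `curvXfo A′ ∘ curvSrcF ν = e2OpMBP₂ τ′ (L^{K+1}) (G′₁ ⊗ 1) (covPieces …) (curvCoefC …) (curvCoefA …) ∘ ι_ν` at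
the flat base point, `η′ = (L^{K+1})⁻¹`, under the two units. [cite: Balaban1985BackgroundPropagators, (3.42) p.397 (third entry, shape), (3.63)–(3.65) pp.402–403] -/
theorem curvXfo_comp_curvSrcF_eq (i : KingVolIndex d) (A' : (curvBgF L n i).Cfg)
    (hunit : IsUnit (1 - LinearMap.toMatrix' (stack (kingGT₁ L a 0 i.K (curvCube L i) κ)
      (covPieces (((L : ℝ) ^ (i.K + 1))⁻¹) (torStep (fine L (fine (L ^ i.K) (curvCube L i))))
        (gaugePair (torStep (fine L (fine (L ^ i.K) (curvCube L i)))) fun (_ : Fin (d + 1)) (_ : Tor (fine L (fine (L ^ i.K) (curvCube L i)))) => (1 : Matrix κ κ ℝ))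
        (kingGT₁ L a 0 i.K (curvCube L i) κ)) ∘ₗ
      unstackM (curvCoefC (((L : ℝ) ^ (i.K + 1))⁻¹) (torStep (fine L (fine (L ^ i.K) (curvCube L i)))) (fun _ _ => 1)
          (expTrField e (((L : ℝ) ^ (i.K + 1))⁻¹) (fun μ y' => adCLM ℝ (A' μ y'))))
        (curvCoefA (((L : ℝ) ^ (i.K + 1))⁻¹) (torStep (fine L (fine (L ^ i.K) (curvCube L i)))) (fun _ _ => 1)
          (expTrField e (((L : ℝ) ^ (i.K + 1))⁻¹) (fun μ y' => adCLM ℝ (A' μ y')))))))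
    (hunit2 : E2Unit (krowOf (fun ν => kingGT₁ L a 0 i.K (curvCube L i) κ ∘ₗ fgradAdj ((L : ℝ) ^ (i.K + 1)) (liftEquiv (torStep (fine L (fine (L ^ i.K) (curvCube L i))) ν) κ))
      (fun μ => pull ⇑(liftEquiv (torStep (fine L (fine (L ^ i.K) (curvCube L i))) μ) κ))
      (fun μ => mmulOp (curvCoefA (((L : ℝ) ^ (i.K + 1))⁻¹) (torStep (fine L (fine (L ^ i.K) (curvCube L i)))) (fun _ _ => 1)
          (expTrField e (((L : ℝ) ^ (i.K + 1))⁻¹) (fun μ y' => adCLM ℝ (A' μ y'))) (Sum.inl μ) ∘ ⇑(torStep (fine L (fine (L ^ i.K) (curvCube L i))) μ).symm))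
      (fun μ => mmulOp (curvCoefA (((L : ℝ) ^ (i.K + 1))⁻¹) (torStep (fine L (fine (L ^ i.K) (curvCube L i)))) (fun _ _ => 1)
          (expTrField e (((L : ℝ) ^ (i.K + 1))⁻¹) (fun μ y' => adCLM ℝ (A' μ y'))) (Sum.inr μ) ∘ ⇑(torStep (fine L (fine (L ^ i.K) (curvCube L i))) μ)))))
    (ν : Fin (d + 1)) :
    curvXfo L κ e a i A' ∘ₗ curvSrcF L κ i ν =
      e2OpMBP₂ (torStep (fine L (fine (L ^ i.K) (curvCube L i)))) ((L : ℝ) ^ (i.K + 1)) (kingGT₁ L a 0 i.K (curvCube L i) κ)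
        (covPieces (((L : ℝ) ^ (i.K + 1))⁻¹) (torStep (fine L (fine (L ^ i.K) (curvCube L i))))
          (gaugePair (torStep (fine L (fine (L ^ i.K) (curvCube L i)))) fun (_ : Fin (d + 1)) (_ : Tor (fine L (fine (L ^ i.K) (curvCube L i)))) => (1 : Matrix κ κ ℝ))
          (kingGT₁ L a 0 i.K (curvCube L i) κ))
        (curvCoefC (((L : ℝ) ^ (i.K + 1))⁻¹) (torStep (fine L (fine (L ^ i.K) (curvCube L i)))) (fun _ _ => 1)
          (expTrField e (((L : ℝ) ^ (i.K + 1))⁻¹) (fun μ y' => adCLM ℝ (A' μ y'))))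
        (curvCoefA (((L : ℝ) ^ (i.K + 1))⁻¹) (torStep (fine L (fine (L ^ i.K) (curvCube L i)))) (fun _ _ => 1)
          (expTrField e (((L : ℝ) ^ (i.K + 1))⁻¹) (fun μ y' => adCLM ℝ (A' μ y')))) ∘ₗ injJ ν := by
  rw [curvXfo, curvSrcF, expTrField_zero]
  exact projO_curvDressed_one_comp_fgradAdj _ _ _ _ _ (inv_inv _) hunit hunit2 ν

/-- ★★ **THE TWO-GRID DEFECT OBJECT OF ENTRY 2 IS FILE 23's**: once both grids' entry 2 are by-parts objects after `ι_ν` (the two theorems above, under their units), part XXXVI's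
`curvOpT i 2 A′ = 𝔇(curvXfo A′ ∘ curvSrcF ν, curvXco V̄ ∘ curvSrcC ν)` IS `𝔇(E₂′, E₂) ∘ ι_ν` through `(pull (liftMap (liftMap π κ) J), pull (liftMap π κ))` (`idef_comp_injJ`) — the object
FILE 23 ★★ `hasMaj_entry2_byParts_matrix₂_of_letters` bounds. [cite: Balaban1985BackgroundPropagators, Thm 3.1 (3.42) p.397 (third entry, shape)] -/
theorem curvOpT_two_eq_of (i : KingVolIndex d × Fin (d + 1)) (A' : (curvBgF L n i.1).Cfg)
    (E₂' : ((Tor (fine L (fine (L ^ i.1.K) (curvCube L i.1))) × κ) × Fin (d + 1) → ℝ) →ₗ[ℝ] (Tor (fine L (fine (L ^ i.1.K) (curvCube L i.1))) × κ → ℝ))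
    (E₂ : ((Tor (fine (L ^ i.1.K) (curvCube L i.1)) × κ) × Fin (d + 1) → ℝ) →ₗ[ℝ] (Tor (fine (L ^ i.1.K) (curvCube L i.1)) × κ → ℝ))
    (hF : curvXfo L κ e a i.1 A' ∘ₗ curvSrcF L κ i.1 i.2 = E₂' ∘ₗ injJ i.2)
    (hC : curvXco L κ e a i.1 ((curvPairing L κ i.1).avg A') ∘ₗ curvSrcC L κ i.1 i.2 = E₂ ∘ₗ injJ i.2) :
    curvOpT L κ e a i 2 A' =
      idef (pull (liftMap (liftMap (blockOf L (fine (L ^ i.1.K) (curvCube L i.1))) κ) (Fin (d + 1)))) (pull (liftMap (blockOf L (fine (L ^ i.1.K) (curvCube L i.1))) κ)) E₂' E₂ ∘ₗ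
        injJ i.2 := by
  show idef _ _ (curvXfo L κ e a i.1 A' ∘ₗ curvSrcF L κ i.1 i.2) (curvXco L κ e a i.1 ((curvPairing L κ i.1).avg A') ∘ₗ curvSrcC L κ i.1 i.2) = _
  rw [hF, hC, idef_comp_injJ]

end King

end Summit.QuantumFields.YangMills.BalabanUVNodes.N15.SiteLayerBg

end
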